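import Literature.AnabelianGeometry.EtaleTheta.Discharge.Sec2Cor29Model
import HarnessLib

/-!
# [EtTh] §2 at the §1 model: the tempered decomposition group of the cusp of `C` — the (B1)–(B3) datum of
# GAP-LEDGER G-L2d3-2 / census item C8 is INHABITED at the arithmetic model by `cuspStabC` (proof-only)

Mochizuki, *The étale theta function and its Frobenioid-theoretic manifestations*, Publ. RIMS **45**
(2009), §2: Def. 2.1 p. 36 ("`ι` … relative to choosing the unique cusp of `X^log` as origin", "`C^log` … the
stack-theoretic quotient of `X^log` by the action of `ι`"), Cor. 2.9 p. 43 [cite: MochizukiEtTh2009, Cor 2.9 p.43];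
[SemiAnbd] Thm. 6.5 (ii)/(iii) p. 71–72 (commensurable terminality / absoluteness of cuspidal decomposition
groups).

Cell abc-iut, layer L2, seat abc-iut-L2-d3 (gen 5); W3-L2-02 residue. PROOF-ONLY (0 defs, no new `Prop` fact;
[SemiAnbd] Thm. 6.5 (ii)/(iii) BY NAME as abc-iut-L3-t2's `DecompCommensurablyTerminal` (F-1658) /
`IsoPreservesCuspidalDecomp` (F-1674)).

abc-iut-w5-d118's `Sec2CuspDecompositionReduction` (p428303) reduced the cusp hypotheses of Cor. 2.9 over an
abstract `T : TemperedCoverData l` to a DATUM «the tempered decomposition group `DC ⊆ Π^tp_C` of the cusp of `C`»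
with (B1) `DC ⊓ Π^tp_X = tp D_x`, (B2) `DC ⊄ Π^tp_X`, (B3) `Comm(DC) ⊆ DC` — the 13:00Z census item C8 (predicate
route `HasCuspDecomp`, since abc-iut-w5-d118's toy `TemperedModel` violates it by design). Here that datum is
PRODUCED at the ARITHMETIC model `T := MuTwoSetting.CLevelData.temperedCoverData …` (ThetaCoversTemperedOfSetting),
with `DC := T.cuspStabC = N_{Π^tp_C}(inclX(D_x))` (`Sec2CuspStabModel.temperedCoverData_cuspStabC`, compact `D_x`):

* (B1) `temperedCoverData_cuspStabC_inf_tp_PiX` — `cuspStabC ⊓ Π^tp_X = tp D_x` ([SemiAnbd] Thm. 6.5 (ii):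
  `N_{Π^tp_X}(D_x) ⊆ Comm(D_x) = D_x`; this seat's `temperedCoverData_cuspStabC_inf_le_tp_Dx`);
* `temperedCoverData_mem_tp_Dx_of_mem_commensurator` — an element of `Π^tp_X` commensurating `inclX(D_x)` lies in
  `inclX(D_x)` (commensurability transported along the injective `inclX`, then Thm. 6.5 (ii));
* (B3) `temperedCoverData_commensurator_cuspStabC_le` — `Comm(cuspStabC) ⊆ cuspStabC`: `cuspStabC` is
  commensurable with `tp D_x` (index `≤ 2`), and an element `g ∉ Π^tp_X` of `Comm(tp D_x)` is `g₀·h` with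
  `g₀ ∈ cuspStabC ∖ Π^tp_X` (B2, «unique cusp» + Thm. 6.5 (iii), `Sec2Cor29Model.temperedCoverData_hC2`) and
  `h ∈ Comm(tp D_x) ∩ Π^tp_X = tp D_x`;
* **`temperedCoverData_exists_cuspDecomp`** — `∃ DC, (B1) ∧ (B2) ∧ (B3)`: the C8 datum EXISTS at the §1 model
  modulo {F-1658, F-1674, «`X^log` has a unique cusp», compact `D_x`} (the shape abc-iut-w5-d118's
  `cor29_card_of_cuspDecomp (hslim h26 hΘ hDCX hι hct)` consumes).

HONEST FRAMING: nothing asserts that a `MuTwoSetting` exists; [EtTh]/[SemiAnbd] are refereed; no side is taken on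
[IUTchIII] Cor. 3.12; typed ≠ proved elsewhere.
-/

namespace Literature.AnabelianGeometry.EtaleTheta

open Literature.AnabelianGeometry.SemiGraphs ThetaCovers
open Subgroup.Commensurable (commensurator)
open _root_.Topology
open scoped Pointwise

namespace MuTwoSetting.CLevelData

variable {p : ℕ} [Fact p.Prime] {M : MuTwoSetting p}
variable {PC : Type} [Group PC] [TopologicalSpace PC] [IsTopologicalGroup PC] [T2Space PC]

section Binders

variable (e : M.CLevelData) (ιC : M.GtpC →ₜ* PC)
    (hιC : IsProfiniteCompletion ιC) (hinj : Function.Injective ιC) (op : M.toThetaSetting.OncePuncturedData)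
    {l : ℕ} (hodd : Odd l) {x : M.Pt} (hx : M.IsCusp x)
    (hIx : ((e.piCDataOf ιC hιC).Dx x ⊓ (e.piCDataOf ιC hιC).augGK.ker) ⊔ (e.piCDataOf ιC hιC).barKer l =
      (e.piCDataOf ιC hιC).barTheta l)
    (hιell : ∀ c ∈ (e.piCDataOf ιC hιC).augGK.ker, c ∉ (e.piCDataOf ιC hιC).PiX →
      ∀ d ∈ (e.piCDataOf ιC hιC).PiX ⊓ (e.piCDataOf ιC hιC).augGK.ker,
        c * d * c⁻¹ * d ∈ (e.piCDataOf ιC hιC).barTheta l)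
    (hN : ((M.GtpXu l).map M.inclX).Normal) (hY : (M.GtpY.map M.inclX).Normal) {S : Subgroup PC}
    (hS : ((e.piCDataOf ιC hιC).coverDataAx l op hx hodd hIx hιell
        ((e.piCDataOf ιC hιC).inv_theta_of_inv_ell l op hιell)).toCoverData.IsSplitting S)
    (hSc : IsClosed (S : Set PC))

/-- **(B1) at the model**: `cuspStabC ⊓ Π^tp_X = tp D_x` (compact `D_x`, [SemiAnbd] Thm. 6.5 (ii) BY NAME).
[cite: MochizukiEtTh2009, Cor 2.9 p.43] -/
theorem temperedCoverData_cuspStabC_inf_tp_PiX (hDc : IsCompact (M.decomp x : Set M.PiTemp))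
    (h65 : M.toTemperedCurve.DecompCommensurablyTerminal) :
    (e.temperedCoverData ιC hιC hinj op hodd hx hIx hιell hN hY hS hSc).cuspStabC ⊓
        (e.temperedCoverData ιC hιC hinj op hodd hx hIx hιell hN hY hS hSc).tp
          (e.temperedCoverData ιC hιC hinj op hodd hx hIx hιell hN hY hS hSc).PiX =
      (e.temperedCoverData ιC hιC hinj op hodd hx hIx hιell hN hY hS hSc).tp
        (e.temperedCoverData ιC hιC hinj op hodd hx hIx hιell hN hY hS hSc).Dx := by
  refine le_antisymm (temperedCoverData_cuspStabC_inf_le_tp_Dx e ιC hιC hinj op hodd hx hIx hιell hN hY hS hSc hDc h65)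
    (le_inf Subgroup.le_normalizer (Subgroup.comap_mono (CoverData.Dx_le _)))

/-- **An element of `Π^tp_X` commensurating `inclX(D_x)` lies in `inclX(D_x)`** ([SemiAnbd] Thm. 6.5 (ii) BY
NAME; commensurability transported along the injective `inclX`). [cite: MochizukiSemiAnbd2006, Thm 6.5(ii) p.71] -/
theorem mem_map_decomp_of_mem_commensurator {x : M.Pt}
    (h65 : M.toTemperedCurve.DecompCommensurablyTerminal) {g : M.GtpC}
    (hg : g ∈ commensurator ((M.decomp x).map M.inclX)) (hgr : g ∈ M.inclX.range) :
    g ∈ (M.decomp x).map M.inclX := by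
  obtain ⟨h, rfl⟩ := hgr
  -- transport the conjugate along `inclX`
  have hsm : ConjAct.toConjAct (M.inclX h) • (M.decomp x).map M.inclX =
      (ConjAct.toConjAct h • M.decomp x).map M.inclX := by
    rw [Subgroup.pointwise_smul_def, Subgroup.pointwise_smul_def, Subgroup.map_map, Subgroup.map_map]
    congr 1
    ext d
    change ConjAct.toConjAct (M.inclX h) • M.inclX d = M.inclX (ConjAct.toConjAct h • d)
    rw [ConjAct.smul_def, ConjAct.smul_def, ConjAct.ofConjAct_toConjAct, ConjAct.ofConjAct_toConjAct, map_mul,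
      map_mul, map_inv]
  rw [Subgroup.Commensurable.commensurator_mem_iff, hsm] at hg
  have hg' : Subgroup.Commensurable (ConjAct.toConjAct h • M.decomp x) (M.decomp x) := by
    obtain ⟨h1, h2⟩ := hg
    rw [Subgroup.relIndex_map_map_of_injective _ _ M.injective_inclX] at h1 h2
    exact ⟨h1, h2⟩
  have hh : h ∈ commensurator (M.decomp x) := (Subgroup.Commensurable.commensurator_mem_iff _ _).2 hg'
  rw [h65 x] at hh
  exact ⟨h, hh, rfl⟩

/-- **(B3) at the model**: `Comm(cuspStabC) ⊆ cuspStabC` — `cuspStabC = N(tp D_x)` is commensurable with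
`tp D_x` (index `≤ [Π^tp_C : Π^tp_X] = 2`), `Comm(tp D_x) ∩ Π^tp_X = tp D_x` ([SemiAnbd] Thm. 6.5 (ii)), and an
element of `Comm(tp D_x)` outside `Π^tp_X` differs from an element of `cuspStabC ∖ Π^tp_X` (B2: «unique cusp» +
Thm. 6.5 (iii)) by an element of `Π^tp_X`. [cite: MochizukiEtTh2009, Cor 2.9 p.43] -/
theorem temperedCoverData_commensurator_cuspStabC_le (hDc : IsCompact (M.decomp x : Set M.PiTemp))
    (h65 : M.toTemperedCurve.DecompCommensurablyTerminal) (huniq : ∀ x' : M.Pt, M.IsCusp x' → x' = x)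
    (h65iii : M.toTemperedCurve.IsoPreservesCuspidalDecomp M.toTemperedCurve) :
    commensurator (e.temperedCoverData ιC hιC hinj op hodd hx hIx hιell hN hY hS hSc).cuspStabC ≤
      (e.temperedCoverData ιC hιC hinj op hodd hx hIx hιell hN hY hS hSc).cuspStabC := by
  set T := e.temperedCoverData ιC hιC hinj op hodd hx hIx hιell hN hY hS hSc with hT
  haveI := T.tp_PiX_normal
  have hB1 := temperedCoverData_cuspStabC_inf_tp_PiX e ιC hιC hinj op hodd hx hIx hιell hN hY hS hSc hDc h65
  have hB2 := temperedCoverData_hC2 e ιC hιC hinj op hodd hx hIx hιell hN hY hS hSc hDc huniq h65iii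
  have hDx : T.tp T.Dx = (M.decomp x).map M.inclX :=
    temperedCoverData_tp_Dx e ιC hιC hinj op hodd hx hIx hιell hN hY hS hSc hDc
  have hPiX : T.tp T.PiX = M.inclX.range :=
    temperedCoverData_tp_PiX e ιC hιC hinj op hodd hx hIx hιell hN hY hS hSc
  -- `cuspStabC` is commensurable with `tp D_x`
  have hcomm : Subgroup.Commensurable T.cuspStabC (T.tp T.Dx) := by
    refine ⟨?_, ?_⟩
    · rw [Subgroup.relIndex_eq_one.2 (hB1 ▸ inf_le_left : T.tp T.Dx ≤ T.cuspStabC)]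
      exact one_ne_zero
    · rw [← hB1, Subgroup.inf_relIndex_left]
      intro h0
      have hdvd := Subgroup.relIndex_dvd_index_of_normal (T.tp T.PiX) T.cuspStabC
      rw [h0] at hdvd
      exact T.index_tp_PiX_ne_zero (Nat.eq_zero_of_zero_dvd hdvd)
  rw [Subgroup.Commensurable.eq hcomm, hDx]
  -- an element of `cuspStabC` outside `Π^tp_X`
  obtain ⟨g₀, hg₀C, hg₀X⟩ := Set.not_subset.1 hB2
  rw [hPiX] at hg₀X
  have hg₀X : g₀ ∉ M.inclX.range := hg₀X
  have hle : (M.decomp x).map M.inclX ≤ T.cuspStabC := by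
    rw [← hDx]; exact Subgroup.le_normalizer
  have hC0 : T.cuspStabC ≤ commensurator ((M.decomp x).map M.inclX) := by
    rw [← hDx]; exact ThetaCovers.normalizer_le_commensurator _
  intro g hg
  by_cases hgr : g ∈ M.inclX.range
  · exact hle (mem_map_decomp_of_mem_commensurator h65 hg hgr)
  · have hprod : (g₀⁻¹ * g : M.GtpC) ∈ M.inclX.range :=
      (Subgroup.mul_mem_iff_of_index_two M.index_range_inclX).2
        ⟨fun h => absurd ((Subgroup.inv_mem_iff _).1 h) hg₀X, fun h => absurd h hgr⟩
    have hmem : g₀⁻¹ * g ∈ commensurator ((M.decomp x).map M.inclX) :=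
      mul_mem (inv_mem (hC0 hg₀C)) hg
    have h1 := hle (mem_map_decomp_of_mem_commensurator h65 hmem hprod)
    have : g = g₀ * (g₀⁻¹ * g) := by group
    rw [this]
    exact mul_mem hg₀C h1

/-- **The tempered decomposition group of the cusp of `C` EXISTS at the §1 model** — the (B1)–(B3) datum of
GAP-LEDGER G-L2d3-2 / census C8, witnessed by `cuspStabC`, modulo [SemiAnbd] Thm. 6.5 (ii)/(iii) BY NAME, the
origin clause «`X^log` has a unique cusp» and compact `D_x` (⟸ a continuous section of `D_x ↠ G_K`). This is the
shape consumed by abc-iut-w5-d118's `cor29_card_of_cuspDecomp`. [cite: MochizukiEtTh2009, Cor 2.9 p.43] -/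
theorem temperedCoverData_exists_cuspDecomp (hDc : IsCompact (M.decomp x : Set M.PiTemp))
    (h65 : M.toTemperedCurve.DecompCommensurablyTerminal) (huniq : ∀ x' : M.Pt, M.IsCusp x' → x' = x)
    (h65iii : M.toTemperedCurve.IsoPreservesCuspidalDecomp M.toTemperedCurve) :
    ∃ DC : Subgroup (e.temperedCoverData ιC hιC hinj op hodd hx hIx hιell hN hY hS hSc).Gtp,
      DC ⊓ (e.temperedCoverData ιC hιC hinj op hodd hx hIx hιell hN hY hS hSc).tp
          (e.temperedCoverData ιC hιC hinj op hodd hx hIx hιell hN hY hS hSc).PiX =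
        (e.temperedCoverData ιC hιC hinj op hodd hx hIx hιell hN hY hS hSc).tp
          (e.temperedCoverData ιC hιC hinj op hodd hx hIx hιell hN hY hS hSc).Dx ∧
      ¬ DC ≤ (e.temperedCoverData ιC hιC hinj op hodd hx hIx hιell hN hY hS hSc).tp
          (e.temperedCoverData ιC hιC hinj op hodd hx hIx hιell hN hY hS hSc).PiX ∧
      commensurator DC ≤ DC :=
  ⟨_, temperedCoverData_cuspStabC_inf_tp_PiX e ιC hιC hinj op hodd hx hIx hιell hN hY hS hSc hDc h65,
    temperedCoverData_hC2 e ιC hιC hinj op hodd hx hIx hιell hN hY hS hSc hDc huniq h65iii,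
    temperedCoverData_commensurator_cuspStabC_le e ιC hιC hinj op hodd hx hIx hιell hN hY hS hSc hDc h65 huniq h65iii⟩

end Binders

end MuTwoSetting.CLevelData

end Literature.AnabelianGeometry.EtaleTheta
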